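import Literature.Computability.Complexity.GateEliminationCase6Core
import Literature.Computability.Complexity.GateEliminationXorReconstruction

/-!
# Gate elimination: preparations for Case 8.2 of Li–Yang's Theorem 4.1

Three ingredients of Case 8.2 of §4.1 (ECCC TR21-023, pp. 31–40), PROVED:

* `Semicircuit.dependsOn_iff_mem_gateSupport`, `Semicircuit.exists_dependsOn_of_nonDegenerate` —
  a gate of the xor-part depends exactly on the variables of its support, and under Case 0.3
  (non-degeneracy: "`Q` does not compute a constant value") it depends on some variable ("`Q`
  computes an affine function depending on a set of protected variables, say `I`" is non-empty);
* `Semicircuit.sol_eq_of_link`, `Semicircuit.dependsOn_of_link` — after the protected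
  substitution of Case 6 (`protSubst_dichotomy_sem`: the solutions of `C` with `x_k := d`
  restrict to the new circuit up to fixed negations) a kept gate of the xor-part still depends on
  every variable `x ≠ x_k` it depended on ("after the substitution `x_k ← d`, `Q` is still a
  `2⁺`-gate computing affine function which depends on the unprotected variable `x_j`",
  Case 8.2.2.1; "`Q′` is also a `2⁺`-gate depending on an unprotected variable `x_j`",
  Case 8.2.2.2);
* `Semicircuit.Standing.exists_reader_of_protected` — the couple bookkeeping: a protected
  variable is read by a (unique, ⊕-type) gate.

## References

* J. Li, T. Yang, *3.1n − o(n) circuit lower bounds for explicit functions*, STOC 2022;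
  ECCC TR21-023, §2.6 (Prop. 2.7), §4.1 (Cases 0.3, 6, 8.2, 8.2.2).
-/

namespace Literature.Computability.Complexity

open Finset

namespace Semicircuit

variable {n : ℕ} {C : Semicircuit n} {f : (Fin n → ZMod 2) → Bool} {R : RdqSource n} {d : ℕ} {αφ αI αQ : ℝ}

/-! ### Dependence and the support -/

/-- A gate of the xor-part depends on `x_s` iff `s` lies in its support. [cite: LiYang2022, Prop. 2.7] -/
theorem dependsOn_iff_mem_gateSupport (hF : C.Fair) {I : Fin C.m} (hI : I ∈ C.xorPart) (s : Fin n) :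
    C.DependsOn hF I s ↔ s ∈ C.gateSupport hF hI := by
  refine ⟨C.mem_gateSupport_of_dependsOn hF hI, fun h => C.dependsOn_of_exists hF hI ⟨fun _ => false, ?_⟩⟩
  rw [C.mem_gateSupport_iff hF hI] at h
  exact h

/-- **A gate of the xor-part with empty support computes a constant.** [folklore] -/
theorem sol_eq_of_gateSupport_eq_empty (hF : C.Fair) {I : Fin C.m} (hI : I ∈ C.xorPart)
    (h : C.gateSupport hF hI = ∅) (x : Fin n → Bool) : C.sol hF x I = C.sol hF (fun _ => false) I := by
  have happ := (C.xorAffine_gate hF hI).apply_eq (boolToZMod2 ∘ x)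
  rw [C.linearPart_eq_sum hF hI, h, sum_empty] at happ
  have hx : boolOfZMod2.symm (boolToZMod2 ∘ x) = x := by
    funext j; rw [Circuit.boolOfZMod2_symm_apply]; show finTwoEquiv (boolToZMod2 (x j)) = x j
    cases x j <;> rfl
  rw [hx] at happ
  rw [happ]
  show (finTwoEquiv (0 : ZMod 2) ^^ C.sol hF (fun _ => false) I) = _
  exact Bool.false_xor _

/-- **Under non-degeneracy a gate of the xor-part depends on some variable** (Case 0.3 excludes
"a gate `G` outputing a fixed constant `c` for any assignment to the variables").
[cite: LiYang2022, §4.1 (Case 0.3, Case 8.2)] -/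
theorem exists_dependsOn_of_nonDegenerate (hF : C.Fair) (hND : C.NonDegenerate) {I : Fin C.m} (hI : I ∈ C.xorPart) :
    ∃ s, C.DependsOn hF I s := by
  by_contra h
  push Not at h
  have hsupp : C.gateSupport hF hI = ∅ := by
    rw [eq_empty_iff_forall_notMem]
    intro s hs
    exact h s ((C.dependsOn_iff_mem_gateSupport hF hI s).mpr hs)
  refine hND I 0 (C.depOnlyOn_of_const (b := C.sol hF (fun _ => false) I) (fun x w hw => ?_) 0)
  rw [hw.eq_sol hF]
  exact C.sol_eq_of_gateSupport_eq_empty hF hI hsupp x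

/-! ### Transfer of dependence along a semantic link -/

/-- **Solutions of the new circuit along a semantic link**: if the solutions of `C` on the inputs
with `x_k := b` restrict, up to fixed negations, to solutions of the fair circuit `K` (as after
the protected substitution of Case 6, `protSubst_dichotomy_sem`), then the solution of `K` IS that
restriction. [folklore] -/
theorem sol_eq_of_link {K : Semicircuit n} (hF : C.Fair) (hK : K.Fair) {ι : Fin K.m → Fin C.m} {σ : Fin C.m → Bool}
    {k : Fin n} {b : Bool}
    (hlink : ∀ (xx : Fin n → Bool) (w : Fin C.m → Bool), C.Consistent (Function.update xx k b) w →
      K.Consistent xx (fun k' => (w (ι k') ^^ σ (ι k'))))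
    (xx : Fin n → Bool) (k' : Fin K.m) :
    K.sol hK xx k' = (C.sol hF (Function.update xx k b) (ι k') ^^ σ (ι k')) := by
  have h := hlink xx _ (C.consistent_sol hF (Function.update xx k b))
  have := h.eq_sol hK
  exact (congrFun this k').symm

/-- **Dependence survives the protected substitution**: along such a link, a kept gate of the
xor-part of `K` depends on every variable `x_s ≠ x_k` on which the corresponding gate of `C`
depends. [cite: LiYang2022, §4.1 (Cases 8.2.2.1, 8.2.2.2)] -/
theorem dependsOn_of_link {K : Semicircuit n} (hF : C.Fair) (hK : K.Fair) {ι : Fin K.m → Fin C.m} {σ : Fin C.m → Bool}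
    {k : Fin n} {b : Bool}
    (hlink : ∀ (xx : Fin n → Bool) (w : Fin C.m → Bool), C.Consistent (Function.update xx k b) w →
      K.Consistent xx (fun k' => (w (ι k') ^^ σ (ι k'))))
    {k' : Fin K.m} (hk' : k' ∈ K.xorPart) {s : Fin n} (hsk : s ≠ k) (hdep : C.DependsOn hF (ι k') s) :
    K.DependsOn hK k' s := by
  refine K.dependsOn_of_exists hK hk' ⟨fun _ => false, ?_⟩
  rw [sol_eq_of_link hF hK hlink, sol_eq_of_link hF hK hlink]
  intro h
  have hupd : Function.update (Function.update (fun _ : Fin n => false) s (!false)) k b =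
      Function.update (Function.update (fun _ : Fin n => false) k b) s
        (!(Function.update (fun _ : Fin n => false) k b s)) := by
    rw [Function.update_of_ne hsk, Function.update_comm hsk]
  rw [hupd] at h
  generalize hα : C.sol hF (Function.update (Function.update (fun _ : Fin n => false) k b) s
    (!(Function.update (fun _ : Fin n => false) k b s))) (ι k') = α at h
  generalize hβ : C.sol hF (Function.update (fun _ : Fin n => false) k b) (ι k') = β at h
  have hne : α ≠ β := by rw [← hα, ← hβ]; exact hdep _
  apply hne
  revert h; cases α <;> cases β <;> cases σ (ι k') <;> decide

/-! ### Couples -/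

/-- Under the standing assumptions a protected variable is read by some gate (Case 2), which is
⊕-type and its only reader (Case 1). [cite: LiYang2022, §4.1 (Cases 1, 2)] -/
theorem Standing.exists_reader_of_protected (hS : C.Standing R) {x : Fin n} (hxp : R.Protected x) :
    ∃ (P : Fin C.m) (a : Fin 2), C.arg P a = .var x ∧ IsXorOp (C.op P) ∧ C.fanout (.var x) = 1 ∧
      ∀ (k : Fin C.m) (a' : Fin 2), C.arg k a' = .var x → k = P := by
  have h1 : 0 < C.fanout (.var x) := by have := hS.protected_pos x hxp; omega
  obtain ⟨P, a, hPa⟩ := exists_reader_of_fanout_pos h1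
  exact ⟨P, a, hPa, hS.isXorOp_of_protected hxp hPa, hS.fanout_eq_one_of_protected hxp hPa,
    fun k a' h => hS.protected_one_reader x hxp k P a' a h hPa⟩

/-- The couple of a protected variable is protected, distinct, and read by the same quadratic
equation. [cite: LiYang2022, §2.3] -/
theorem _root_.Literature.Computability.Complexity.RdqSource.couple_spec {R : RdqSource n} {l x : Fin n} {e : QuadEq n}
    (he : R.quad l = some e) (hx : e.Reads x) :
    e.Reads (e.other x) ∧ R.Protected (e.other x) ∧ e.other x ≠ x :=
  ⟨e.reads_other x, RdqSource.protected_of_reads he (e.reads_other x), e.other_ne hx (R.quad_wf l e he).2.2⟩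

/-! ### The reader of a protected variable is not the output -/

/-- **An affine gate on top of the xor-part is not the output**: a gate with affine function all
of whose gate wires go into the xor-part computes a xor-affine function of the input, which an
affine disperser (dimension `≥ 2d + 1`) is not. (Li–Yang, footnote 5 of §2.6: the output "is
clearly not in the cyclic xor-circuit"; here for a ⊕-type gate reading a variable and a gate of
the xor-part, e.g. the reader of a protected variable in Case 8.2.) [cite: LiYang2022, §2.6 (footnote 5)] -/
theorem out_ne_gate_of_affine_over_xorPart (hf : IsAffineDisperser f d) (hd : 2 * d + 1 ≤ R.dim) (hF : C.Fair)
    (hC : C.ComputesRestr f R) {P : Fin C.m} (hP : IsAffineOp (C.op P))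
    (hPin : ∀ (a : Fin 2) (k : Fin C.m), C.arg P a = .gate k → k = P ∨ k ∈ C.xorPart) : C.out ≠ .gate P := by
  classical
  intro hout
  have hcl : C.IsClosed (insert P C.xorPart) := by
    intro k hk a k' h
    rw [mem_insert] at hk ⊢
    rcases hk with rfl | hk
    · exact hPin a k' h
    · exact Or.inr (C.mem_of_arg_eq k hk a k' h)
  have haff : IsXorAffine (C.nodeFn hF C.out) :=
    C.nodeFn_xorAffine hF hcl (fun k hk => by
      rw [mem_insert] at hk
      rcases hk with rfl | hk
      · exact hP
      · exact (C.isXorOp_of_mem k hk).isAffineOp)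
      (fun k' h => by rw [hout] at h; cases h; exact mem_insert_self _ _)
  refine hf.not_xorAffine_on_sol R hd haff fun v hv => ?_
  exact (hC.2 v hv _ (C.consistent_sol hF _)).symm

/-- In particular, under the standing assumptions the reader `P` of a protected variable whose
other wire is a variable or a gate of the xor-part is not the output, so it has a reader
(pre-normalized: the only `0`-gate is the output). [cite: LiYang2022, §4.1 (Case 8.2)] -/
theorem fanout_pos_of_protected_reader (hf : IsAffineDisperser f d) (hd : 2 * d + 1 ≤ R.dim) (hF : C.Fair)
    (hC : C.ComputesRestr f R) (hS : C.Standing R) {P : Fin C.m} {a : Fin 2} {x : Fin n} (hPx : C.arg P a = .var x)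
    (hxp : R.Protected x) (hother : ∀ k, C.arg P a.rev = .gate k → k ∈ C.xorPart) : 0 < C.fanout (.gate P) := by
  by_contra h0
  push Not at h0
  have hout := hS.normalized.1.out_of_fanout_eq_zero P (Nat.le_zero.mp h0)
  refine out_ne_gate_of_affine_over_xorPart hf hd hF hC (hS.isXorOp_of_protected hxp hPx).isAffineOp
    (fun a' k h => ?_) hout
  rcases fin2_eq_or_eq_rev a a' with rfl | rfl
  · rw [hPx] at h; cases h
  · exact Or.inr (hother k h)

end Semicircuit

end Literature.Computability.Complexity
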